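import Mathlib
import Summits.PneNP.PneNP.Theorems.PstarPCPaths

/-!
# Parity decision trees give low-degree `PC/𝔽₂` refutations of pure `P⋆` fibres (ROUND-24 pre-seed, item T24.3b)

FRONTIER range-avoidance ladder, rung F-N3 (cell `pnp-ideate`; memo `HOME/pnp-ideate-p3/r24/ROUND-24-PRESEED.md` §6(3);
restricted-model proof complexity — nothing here bears on `P` vs `NP`).

For a pure `P⋆ = u₀ ⊕ u₁ ⊕ u₂u₃` instance `I : LocalMap 4 n m` and a target `y`, `PstarFibrePolys` fixed the polynomial system
`fibrePolys I y = {X u + X v + X p·X q + y_j}_j ⊆ 𝔽₂[X]` of the fibre `I(z) = y` and the tree's polynomial calculus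
`PC.DerivableInDegree / RefutableInDegree` (Boolean axioms built in).  This file places the parity-decision-tree rung of `PstarPDT`
BELOW the `PC/𝔽₂`-degree rung:

* `pc_refutable_of_solves` — if a parity decision tree `T` solves `Search(I, y)` then `fibrePolys I y` has a `PC/𝔽₂` refutation of
  degree `≤ T.depth + 2`;
* `pc_refutable_depth_le` — with the T24.2 upper bound (`PstarPDTUpper.exists_solves_depth_le`): every non-image fibre of a pure `P⋆`
  instance is `PC/𝔽₂`-refutable in degree `≤ #(andVars I) + ⌈log₂ m⌉ + 2`; `not_mem_range_iff_refutable` — so `PC/𝔽₂`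
  refutability (in some degree) characterises `y ∉ Range(I)`.

Consequently an `Ω(n)` degree lower bound for `PC/𝔽₂` on these fibres (the named open problem T21.2) implies the `Ω(n)` parity
decision tree depth bound (the held R24 statement), and both must charge the AND layer.

## Proof

Induction over the tree, carrying the path `P` of answered parity queries as extra degree-`1` axioms `axOf (S, b) = Σ_{v∈S} X_v + b`
(`refutable_on_path`: if `T` reaches a violated output on every input of the cell of `P`, then `fibrePolys I y ∪ pathAx P` is refutable
in degree `T.depth + 2`).
* LEAF `j = (u, v, p, q)` (degree `2`, `leaf_refutable`): write `fibreAxiom_j + 1 = φ₀ + X_p X_q` with `φ₀ = X_u + X_v + y_j + 1`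
  affine, and `φ₁ = φ₀ + X_q`.  On the cell every input violates output `j`, so on the sub-cell `x_p = a` the AFFINE equation
  `φ_a = 0` holds; affine completeness (`PstarPCPaths.exists_cert`, the `𝔽₂` Fredholm alternative) makes `μ φ_a + (1 + μ)` a
  combination of the path axioms and the pin `X_p + a`; multiplying by the indicator `ι_a ∈ {X_p, X_p + 1}` of `x_p = a` turns the
  pin into the Boolean axiom `X_p² − X_p`, so `ι_a φ_a` is derivable in degree `2` (for `μ = 0` via `ι_a` itself); finally
  `ι₁ φ₁ + ι₀ φ₀ = fibreAxiom_j + 1` identically in characteristic `2`, and adding the axiom `fibreAxiom_j` gives `1`.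
* NODE `⊕_S` (degree `+1`, `PstarPCPaths.refutable_of_split`): the children refute `𝓖 ∪ {g}` and `𝓖 ∪ {g + 1}` for the parity
  form `g = Σ_{v∈S} X_v`; multiplying the first refutation through by `g + 1` and the second by `g` (the axiom becomes
  `g (g + 1) = Σ_{v∈S} (X_v² − X_v)`, a sum of Boolean axioms) gives `𝓖 ⊢ g + 1` and `𝓖 ⊢ g`, whose sum is `1`.
-/

set_option linter.dupNamespace false

open Finset MvPolynomial Literature.Computability.Complexity Literature.Computability.MetaComplexity
open Summit.PneNP.PneNP.Theorems.PstarFibrePolys (bit bit_xor bit_and bit_injective bit_add_bit_eq_zero_iff fibreAxiom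
  fibrePolys pstarPoly derivable_fibreAxiom not_mem_range_of_refutable)

namespace Summit.PneNP.PneNP.Theorems.PstarPDT

variable {n m : ℕ}

/-- Every element of `𝔽₂` is `0` or `1`. -/
private theorem zmod2_cases' (a : ZMod 2) : a = 0 ∨ a = 1 := by
  revert a; decide

/-! ## The leaf -/

section Leaf

variable (I : LocalMap 4 n m) (y : Fin m → Bool)

/-- The affine equation of the leaf `j = (u, v, p, q)` on the sub-cell `x_p = a`: coefficients `e_u + e_v + a·e_q`, right-hand side
`y_j + 1` (so its discrepancy is `z_u + z_v + a z_q + y_j + 1`, which vanishes exactly when output `j` is VIOLATED given `z_p = a`). -/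
def leafRow (j : Fin m) (a : Bool) : LinEqMod 2 n :=
  (fun w => (if w = I.vars j 0 then 1 else 0) + (if w = I.vars j 1 then 1 else 0) +
      (if a = true then (if w = I.vars j 3 then 1 else 0) else 0), bit (y j) + 1)

/-- The affine polynomial `φ_a = X_u + X_v + a X_q + y_j + 1` of the leaf equation. -/
theorem affPolyL_leafRow (j : Fin m) (a : Bool) : affPolyL (leafRow I y j a) =
    X (I.vars j 0) + X (I.vars j 1) + (if a = true then X (I.vars j 3) else 0) + (C (bit (y j)) + 1) := by
  cases a
  · simp only [affPolyL_apply, leafRow, Bool.false_eq_true, if_false, add_zero, add_smul, sum_add_distrib, ite_smul, one_smul,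
      zero_smul, sum_ite_eq', mem_univ, if_true, map_add, map_one]
  · simp only [affPolyL_apply, leafRow, if_true, add_smul, sum_add_distrib, ite_smul, one_smul, zero_smul, sum_ite_eq', mem_univ,
      map_add, map_one]

/-- Its discrepancy at a Boolean point. -/
theorem disc_leafRow (j : Fin m) (a : Bool) (z : Fin n → Bool) : disc (leafRow I y j a) z =
    bit (z (I.vars j 0)) + bit (z (I.vars j 1)) + (if a = true then bit (z (I.vars j 3)) else 0) + (bit (y j) + 1) := by
  cases a
  · simp only [disc, linVal, leafRow, Bool.false_eq_true, if_false, add_zero, add_mul, sum_add_distrib, ite_mul, one_mul, zero_mul,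
      sum_ite_eq', mem_univ, if_true]
  · simp only [disc, linVal, leafRow, if_true, add_mul, sum_add_distrib, ite_mul, one_mul, zero_mul, sum_ite_eq', mem_univ]

variable {I y}

/-- On the sub-cell `x_p = a`, a violated output `j` means the leaf equation holds (its discrepancy vanishes). -/
theorem disc_leafRow_eq_zero (hI : I.IsPure xorAndPred) (j : Fin m) (a : Bool) (z : Fin n → Bool) (hzp : z (I.vars j 2) = a)
    (hne : I.eval z j ≠ y j) : disc (leafRow I y j a) z = 0 := by
  have e1 := bit_eval hI z j
  rw [hzp] at e1
  have e2 : bit (I.eval z j) + bit (y j) = 1 := by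
    rcases zmod2_cases' (bit (I.eval z j) + bit (y j)) with h | h
    · exact absurd ((bit_add_bit_eq_zero_iff _ _).1 h) hne
    · exact h
  have hite : (if a = true then bit (z (I.vars j 3)) else 0) = bit a * bit (z (I.vars j 3)) := by
    cases a <;> simp [bit]
  have h11 : (1 : ZMod 2) + 1 = 0 := by decide
  rw [disc_leafRow, hite]
  linear_combination e2 - e1 + h11

/-- **The leaf in degree `2`.**  If every input of the cell of the path `P` violates output `j`, then `fibrePolys I y ∪ pathAx P` is
refutable in degree `2`. -/
theorem leaf_refutable (hI : I.IsPure xorAndPred) (P : List (Finset (Fin n) × Bool)) (j : Fin m)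
    (hW : ∀ z : Fin n → Bool, (∀ q ∈ P, parity q.1 z = q.2) → I.eval z j ≠ y j) :
    PC.DerivableInDegree (fibrePolys I y ∪ pathAx P) 2 1 := by
  set 𝓖 := fibrePolys I y ∪ pathAx P with h𝓖
  have hF : PC.DerivableInDegree 𝓖 2 (fibreAxiom I y j) :=
    (derivable_fibreAxiom I y j le_rfl).mono_set Set.subset_union_left
  have h0 : PC.DerivableInDegree 𝓖 2 0 := derivable_zero_of hF
  have h2 : (2 : MvPolynomial (Fin n) (ZMod 2)) = 0 := CharTwo.two_eq_zero
  set p := I.vars j 2 with hp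
  -- the indicator of the sub-cell `x_p = a`
  set ι : Bool → MvPolynomial (Fin n) (ZMod 2) := fun a => if a = true then X p else X p + 1 with hι
  have hιdeg : ∀ a, (ι a).totalDegree ≤ 1 := by
    intro a
    cases a
    · exact (totalDegree_add _ _).trans (max_le (totalDegree_X (R := ZMod 2) p).le (by simp))
    · exact (totalDegree_X (R := ZMod 2) p).le
  -- `ι_a` times the pin axiom `X_p + a` is the Boolean axiom of `p`
  have hιpin : ∀ a, ι a * axOf ({p}, a) = X p ^ 2 - X p := by
    intro a
    cases a
    · simp only [hι, axOf, linPoly, sum_singleton, bit, Bool.false_eq_true, if_false, map_zero, add_zero]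
      linear_combination (X p) * h2
    · simp only [hι, axOf, linPoly, sum_singleton, bit, if_true, map_one]
      linear_combination (X p) * h2
  -- the key step: `ι_a φ_a` is derivable in degree 2
  have hkey : ∀ a, PC.DerivableInDegree 𝓖 2 (ι a * affPolyL (leafRow I y j a)) := by
    intro a
    obtain ⟨μ, hμ⟩ := exists_cert (({p}, a) :: P) (leafRow I y j a) (by
      intro z hz
      rw [List.forall_mem_cons] at hz
      obtain ⟨hzp, hz'⟩ := hz
      rw [parity_singleton] at hzp
      exact disc_leafRow_eq_zero hI j a z hzp (hW z hz'))
    have hq : ∀ q ∈ ({p}, a) :: P, PC.DerivableInDegree 𝓖 2 (ι a * axOf q) := by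
      intro q hq
      rcases List.mem_cons.1 hq with rfl | hq
      · rw [hιpin]
        exact PC.DerivableInDegree.booleanAxiom p (totalDegree_boolAx_le p)
      · rw [mul_comm]
        have hdq := totalDegree_axOf_le q
        have hdi := hιdeg a
        exact (PC.DerivableInDegree.hyp (Or.inr (axOf_mem_pathAx hq)) (hdq.trans one_le_two)).mul (ι a)
          ((totalDegree_mul _ _).trans (by omega))
    have hd := hμ 𝓖 2 (ι a) h0 hq
    rcases zmod2_cases' μ with rfl | rfl
    · have h1 : ι a * ((0 : ZMod 2) • affPolyL (leafRow I y j a) + C (1 + 0)) = ι a := by simp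
      rw [h1] at hd
      have hdi := hιdeg a
      have hdφ := totalDegree_affPolyL_le (leafRow I y j a)
      exact hd.mul _ ((totalDegree_mul _ _).trans (by omega))
    · have h1 : ι a * ((1 : ZMod 2) • affPolyL (leafRow I y j a) + C (1 + 1)) = ι a * affPolyL (leafRow I y j a) := by
        have e : (1 : ZMod 2) + 1 = 0 := by decide
        simp [e]
      rw [h1] at hd
      exact hd
  -- assemble: `ι₁ φ₁ + ι₀ φ₀ + fibreAxiom_j = 1`
  have hsum := ((hkey true).add (hkey false)).add hF
  have hid : ι true * affPolyL (leafRow I y j true) + ι false * affPolyL (leafRow I y j false) + fibreAxiom I y j = 1 := by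
    simp only [hι, affPolyL_leafRow, if_true, Bool.false_eq_true, if_false, add_zero, fibreAxiom, pstarPoly, ← hp]
    linear_combination (X p * (X (I.vars j 0) + X (I.vars j 1) + C (bit (y j))) + X p * X (I.vars j 3) + X p +
      (X (I.vars j 0) + X (I.vars j 1) + C (bit (y j)))) * h2
  rw [hid] at hsum
  exact hsum

end Leaf

/-! ## The induction over the tree -/

variable {I : LocalMap 4 n m} {y : Fin m → Bool}

/-- **Paths.**  If the tree `T` reaches a violated output on every input of the cell of the path `P`, then `fibrePolys I y ∪ pathAx P`
is `PC/𝔽₂`-refutable in degree `T.depth + 2`. -/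
theorem refutable_on_path (hI : I.IsPure xorAndPred) : ∀ (T : PDT n m) (P : List (Finset (Fin n) × Bool)),
    (∀ z : Fin n → Bool, (∀ q ∈ P, parity q.1 z = q.2) → I.eval z (T.run z) ≠ y (T.run z)) →
    PC.DerivableInDegree (fibrePolys I y ∪ pathAx P) (T.depth + 2) 1 := by
  intro T
  induction T with
  | leaf j =>
    intro P hW
    exact leaf_refutable hI P j hW
  | node S t₀ t₁ ih₀ ih₁ =>
    intro P hW
    -- the children solve the two sub-cells
    have h₀raw : PC.DerivableInDegree (fibrePolys I y ∪ pathAx ((S, false) :: P)) (t₀.depth + 2) 1 := by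
      refine ih₀ ((S, false) :: P) fun z hz => ?_
      rw [List.forall_mem_cons] at hz
      have h := hW z hz.2
      have hpar : parity S z = false := hz.1
      simp only [PDT.run, hpar, Bool.false_eq_true, if_false] at h
      exact h
    have h₁raw : PC.DerivableInDegree (fibrePolys I y ∪ pathAx ((S, true) :: P)) (t₁.depth + 2) 1 := by
      refine ih₁ ((S, true) :: P) fun z hz => ?_
      rw [List.forall_mem_cons] at hz
      have h := hW z hz.2
      have hpar : parity S z = true := hz.1
      simp only [PDT.run, hpar, if_true] at h
      exact h
    set 𝓖 := fibrePolys I y ∪ pathAx P with h𝓖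
    set D := max t₀.depth t₁.depth + 2 with hD
    have hsub : ∀ b : Bool, fibrePolys I y ∪ pathAx ((S, b) :: P) ⊆ 𝓖 ∪ {axOf (S, b)} := by
      intro b g hg
      rw [pathAx_cons] at hg
      rcases hg with hg | rfl | hg
      · exact Or.inl (Or.inl hg)
      · exact Or.inr rfl
      · exact Or.inl (Or.inr hg)
    have e₀ : axOf (S, false) = linPoly S := by simp [axOf, bit]
    have e₁ : axOf (S, true) = linPoly S + 1 := by simp [axOf, bit]
    have h₀ : PC.DerivableInDegree (𝓖 ∪ {linPoly S}) D 1 := by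
      rw [← e₀]
      exact (h₀raw.mono_set (hsub false)).mono (by omega)
    have h₁ : PC.DerivableInDegree (𝓖 ∪ {linPoly S + 1}) D 1 := by
      rw [← e₁]
      exact (h₁raw.mono_set (hsub true)).mono (by omega)
    -- `g (g + 1)` from the Boolean axioms (some axiom of the fibre system provides `0`)
    have hF : PC.DerivableInDegree 𝓖 (D + 1) (fibreAxiom I y (t₀.run fun _ => false)) :=
      (derivable_fibreAxiom I y _ (by omega)).mono_set Set.subset_union_left
    have hgg := derivable_linPoly_mul_succ (show 2 ≤ D + 1 by omega) (derivable_zero_of hF) S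
    have hdep : (PDT.node S t₀ t₁).depth + 2 = D + 1 := by
      simp only [PDT.depth]
      omega
    rw [hdep]
    exact refutable_of_split (by omega) (linPoly S) (totalDegree_linPoly_le S) hgg h₀ h₁

/-- **T24.3b — a parity decision tree solving `Search(I, y)` yields a `PC/𝔽₂` refutation of the fibre system of degree
`≤ depth + 2`.** -/
theorem pc_refutable_of_solves (hI : I.IsPure xorAndPred) {T : PDT n m} (hT : T.Solves I y) :
    PC.RefutableInDegree (fibrePolys I y) (T.depth + 2) := by
  have h := refutable_on_path (y := y) hI T [] fun z _ => hT z
  rwa [pathAx_nil, Set.union_empty] at h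

/-- With the T24.2 upper bound: every non-image fibre of a pure `P⋆` instance is `PC/𝔽₂`-refutable in degree
`≤ #(andVars I) + ⌈log₂ m⌉ + 2` (pin the AND layer, binary search, then this file). -/
theorem pc_refutable_depth_le (hI : I.IsPure xorAndPred) (hy : y ∉ I.range) :
    PC.RefutableInDegree (fibrePolys I y) ((andVars I).card + Nat.clog 2 m + 2) := by
  obtain ⟨T, hT, hd⟩ := exists_solves_depth_le hI hy
  exact (pc_refutable_of_solves hI hT).mono (by omega)

/-- Hence, for pure `P⋆` instances, `y ∉ Range(I)` iff the fibre system is `PC/𝔽₂`-refutable in some degree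
(soundness is `PstarFibrePolys.not_mem_range_of_refutable`). -/
theorem not_mem_range_iff_refutable (hI : I.IsPure xorAndPred) :
    y ∉ I.range ↔ ∃ d : ℕ, PC.RefutableInDegree (fibrePolys I y) d :=
  ⟨fun hy => ⟨_, pc_refutable_depth_le hI hy⟩, fun ⟨_, h⟩ => not_mem_range_of_refutable I hI y h⟩

end Summit.PneNP.PneNP.Theorems.PstarPDT
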